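import Summits.RiemannHypothesis.RiemannHypothesis.Theorems.TiltedLandingLaw421R3FLinkGainSeam

/-! # GainRegime — REGIME DOORS for the seam-bindered gain socket (C4 W-09 «kernel desk»; BLOCK 154 «C3 g54/C4 g42 on the corner-cell lemma»)
ONE tree import: `…R3FLinkGainSeam` (#1241, the registered-side socket `RhW08.FLinkGainSeam.RemainderGainBoxSeamSig θ`, typed OPEN).
WHAT THIS FILE DOES (statement-neutral plumbing; no socket of record is touched, no new law is asserted):
* `RemainderGainBoxSeamUnder P θ` — the socket RESTRICTED to a regime `P` (a predicate on the full binder data `η f x₀ s hmax R Hs B j v w`,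
  inserted as the LAST antecedent).  Doors: restriction (`under_of_sig`), antitonicity in `P`, monotonicity in `θ`, and ★ RE-ASSEMBLY from any
  COVER `P ∨ Q` with PER-REGIME allowances: `sig_of_under_cover₂ : Under P θ₁ → Under Q θ₂ → (cover) → RemainderGainBoxSeamSig (max θ₁ θ₂)`.
* NAMED REGIMES of record: `ThinFrameP` (DESIGN NOTE 3 binders `270·Hs ≤ R ∧ 540·s < R`), `EmptyConeFrameP` (C3 memo LOWGAIN §4 (F′): `Hs + hmax < R/2`),
  `ConeFreeP` (C3 regime (I) «cone unreachable», §4 (P4)/(P5): `Hs² < (R/2 − |δ|)² + y²`, `δ = w.re − v.re`, `y = w.im`) and its complement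
  `CornerCellP` (the CORNER CELL).  Kernel facts: Thin ⇒ EmptyCone ⇒ ConeFree along the socket's own binders (`3·hmax < R`, `|δ| ≤ v.im ≤ hmax`), hence
  `Under ConeFreeP θ → Under ThinFrameP θ` (the bulk law covers every thin frame — DESIGN NOTE 3 (i) as a theorem), and
  ★ `sig_of_coneFree_and_cornerCell : Under ConeFreeP θ₁ → Under CornerCellP θ₂ → RemainderGainBoxSeamSig (max θ₁ θ₂)` — the registered-side socket
  is EXACTLY «bulk law ∧ corner-cell lemma», each with its own allowance.
* GEOMETRY of the label: in the cone-free regime every far point `u` of the strip (`|Im u| ≤ Hs`, `|Re u − Re v| ≥ R/2`) leaves the child `w`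
  UNCOVERED in the tree's sense — `(Im u)² < (Im w)² + (Re w − Re u)²` (`far_uncovered`), which is exactly the right-hand side of
  `RhW08.UncoveredSign.pairPull_neg_iff` (…R3RateUncoveredSign: the pair `u, ū` then pulls `w` strictly DOWN) and of lens-1's
  `RhW08.Lens1ArcSign.pairTerm_neg` — C3 (P2)'s sign rule is thus ALREADY in the tree twice and is cited, not restated (neither file is imported here).
Honest reading: every `Under P θ` is a HYPOTHESIS schema (typed OPEN); nothing here proves any instance of the gain law.  C3's socket §3″
`RhW08.FLinkSeam.FLinkBoxSeamSig'` gets the same doors through the 90↔91 bridge `fLinkBoxSeamSig'_of_remainderGainBoxSeam` (RSV-93, keyed; no second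
`Under` is typed here).  Sorry-free; no type-class
declarations, no custom syntax, no option changes.  Nothing here bears on the truth of RH; RH is NOT proved; ⟨33346⟩/⟨33347⟩ OPEN; checked ≠ landed ≠ proved. -/

noncomputable section

namespace RhW08.GainRegime

open Complex Filter Topology
open scoped ComplexConjugate
open RhW08.Round1 RhW08.StSwap RhW08.Round2 RhW08.QuadW
open RhW08.SealSwap (PBot)
open RhW08.SealSwapQ RhW08.RateSplit RhW08.IsolatedTilt RhW08.FarStep RhW08.BurgersRate RhW08.PurseP RhW08.BurgersRateG3
open RhIdea6.G17.W07C7 RhIdea6.G17.W07C7.Rev6 RhIdea6.G18.W07C8.Law421BirthS RhIdea6.G19.W07C11.Seam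
open RhIdea6.G20.W07C12.Frac RhIdea6.G20.W07C12.StColP RhW07.C12.FieldSplit RhIdea6.G21.W07C13.TentMax
open RhW07.C14.TwoSided RhW07.C14.Classes RhW07.C14.Lineage RhW07.C14.Booking
open RhW08.FLink RhW08.FLinkGain RhW08.FLinkGainSeam

/-- A REGIME is a predicate on the socket's full binder data `(η, f, x₀, s, hmax, R, Hs, B, j, v, w)`. -/
abbrev RegimePred : Type := ℝ → (ℂ → ℂ) → ℝ → ℝ → ℝ → ℝ → ℝ → ℕ → ℕ → ℂ → ℂ → Prop

/-- (T-schema, OPEN) the seam-bindered remainder gain law RESTRICTED TO THE REGIME `P`: `RemainderGainBoxSeamSig θ`'s binders verbatim, with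
`P η f x₀ s hmax R Hs B j v w` as one more (last) hypothesis. -/
def RemainderGainBoxSeamUnder (P : RegimePred) (θ : ℝ) : Prop :=
  ∀ (η : ℝ) (f : ℂ → ℂ) (x₀ s hmax R Hs : ℝ) (B : ℕ), EngineHyps5 2 η f x₀ s hmax R Hs B →
    ∀ (j : ℕ) (v w : ℂ), FarLevelQ η f x₀ s hmax R Hs B j → Charged (PTrkSQ PBot) StTrkDQ ReadyR2 η f x₀ s hmax R Hs B j →
      IsLowest StTrkDQ η f x₀ s hmax R Hs B j v → |v.re - x₀| ≤ R / 2 → v.im ≤ hmax → LevelRemainderBox η f x₀ s hmax R j →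
      iteratedDeriv j f w ≠ 0 → (∀ z : ℂ, iteratedDeriv j f z = 0 → |z.re - v.re| < R / 2 → z = v ∨ z = conj v) →
      iteratedDeriv (j + 1) f w = 0 → 0 < w.im → ‖w - (v.re : ℂ)‖ ≤ |v.im| →
      P η f x₀ s hmax R Hs B j v w →
        ‖lineRem f j v R w‖ ≤ ‖lineRem f j v R (linePt v w)‖ + θ * η / s

/-- (K) RESTRICTION: the socket gives its restriction to any regime. -/
theorem under_of_sig {P : RegimePred} {θ : ℝ} (h : RemainderGainBoxSeamSig θ) : RemainderGainBoxSeamUnder P θ := by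
  intro η f x₀ s hmax R Hs B hE j v w hfar hch hlow hcol hh hRB hw0 hiso hw1 hwim hdisc _hP
  exact h η f x₀ s hmax R Hs B hE j v w hfar hch hlow hcol hh hRB hw0 hiso hw1 hwim hdisc

/-- (K) ANTITONE IN THE REGIME: a law on a larger regime gives the law on a smaller one. -/
theorem under_antitone {P Q : RegimePred} {θ : ℝ} (hQP : ∀ η f x₀ s hmax R Hs B j v w, Q η f x₀ s hmax R Hs B j v w → P η f x₀ s hmax R Hs B j v w)
    (h : RemainderGainBoxSeamUnder P θ) : RemainderGainBoxSeamUnder Q θ := by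
  intro η f x₀ s hmax R Hs B hE j v w hfar hch hlow hcol hh hRB hw0 hiso hw1 hwim hdisc hQ
  exact h η f x₀ s hmax R Hs B hE j v w hfar hch hlow hcol hh hRB hw0 hiso hw1 hwim hdisc (hQP η f x₀ s hmax R Hs B j v w hQ)

/-- (K) MONOTONE IN THE ALLOWANCE (uses only `0 < s` and `0 ≤ η` of the frame). -/
theorem under_mono_theta {P : RegimePred} {θ θ' : ℝ} (hle : θ ≤ θ') (h : RemainderGainBoxSeamUnder P θ) : RemainderGainBoxSeamUnder P θ' := by
  intro η f x₀ s hmax R Hs B hE j v w hfar hch hlow hcol hh hRB hw0 hiso hw1 hwim hdisc hP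
  have h1 := h η f x₀ s hmax R Hs B hE j v w hfar hch hlow hcol hh hRB hw0 hiso hw1 hwim hdisc hP
  obtain ⟨_, _, _, hs, _, _, _, _, _, _, _, _, _, hη, _, _⟩ := hE
  have h2 : θ * η / s ≤ θ' * η / s := by
    apply div_le_div_of_nonneg_right _ hs.le
    exact mul_le_mul_of_nonneg_right hle hη
  linarith

/-- (K) the trivial regime is the socket itself. -/
theorem sig_iff_under_true {θ : ℝ} :
    RemainderGainBoxSeamUnder (fun _ _ _ _ _ _ _ _ _ _ _ => True) θ ↔ RemainderGainBoxSeamSig θ := by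
  constructor
  · intro h η f x₀ s hmax R Hs B hE j v w hfar hch hlow hcol hh hRB hw0 hiso hw1 hwim hdisc
    exact h η f x₀ s hmax R Hs B hE j v w hfar hch hlow hcol hh hRB hw0 hiso hw1 hwim hdisc trivial
  · exact fun h => under_of_sig h

/-- ★ (K) RE-ASSEMBLY FROM A COVER: laws on two regimes that jointly cover every configuration give the socket. -/
theorem sig_of_under_cover {P Q : RegimePred} {θ : ℝ}
    (hcov : ∀ η f x₀ s hmax R Hs B j v w, P η f x₀ s hmax R Hs B j v w ∨ Q η f x₀ s hmax R Hs B j v w)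
    (hP : RemainderGainBoxSeamUnder P θ) (hQ : RemainderGainBoxSeamUnder Q θ) : RemainderGainBoxSeamSig θ := by
  intro η f x₀ s hmax R Hs B hE j v w hfar hch hlow hcol hh hRB hw0 hiso hw1 hwim hdisc
  rcases hcov η f x₀ s hmax R Hs B j v w with hp | hq
  · exact hP η f x₀ s hmax R Hs B hE j v w hfar hch hlow hcol hh hRB hw0 hiso hw1 hwim hdisc hp
  · exact hQ η f x₀ s hmax R Hs B hE j v w hfar hch hlow hcol hh hRB hw0 hiso hw1 hwim hdisc hq

/-- ★ (K) … with PER-REGIME ALLOWANCES: the socket holds at `max θ₁ θ₂`. -/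
theorem sig_of_under_cover₂ {P Q : RegimePred} {θ₁ θ₂ : ℝ}
    (hcov : ∀ η f x₀ s hmax R Hs B j v w, P η f x₀ s hmax R Hs B j v w ∨ Q η f x₀ s hmax R Hs B j v w)
    (hP : RemainderGainBoxSeamUnder P θ₁) (hQ : RemainderGainBoxSeamUnder Q θ₂) : RemainderGainBoxSeamSig (max θ₁ θ₂) :=
  sig_of_under_cover hcov (under_mono_theta (le_max_left θ₁ θ₂) hP) (under_mono_theta (le_max_right θ₁ θ₂) hQ)

/-- (K) SPLIT form: a regime and its complement. -/
theorem sig_of_under_split {P : RegimePred} {θ : ℝ} (hP : RemainderGainBoxSeamUnder P θ)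
    (hQ : RemainderGainBoxSeamUnder (fun η f x₀ s hmax R Hs B j v w => ¬ P η f x₀ s hmax R Hs B j v w) θ) :
    RemainderGainBoxSeamSig θ :=
  sig_of_under_cover (fun η f x₀ s hmax R Hs B j v w => Classical.em (P η f x₀ s hmax R Hs B j v w)) hP hQ

/-! ## Named regimes of record -/

/-- THIN FRAMES (DESIGN NOTE 3 / C3 NOTE-4): `270·Hs ≤ R ∧ 540·s < R` — the frames `closes` actually consumes (`Hs = 1/2`, `R = 135`, `s = s(γ) < 1/4`). -/
def ThinFrameP : RegimePred := fun _η _f _x₀ s _hmax R Hs _B _j _v _w => 270 * Hs ≤ R ∧ 540 * s < R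

/-- EMPTY-CONE FRAMES (C3 memo LOWGAIN §4 (F′) «empty light cone, `Hs + hmax ≪ R/2`», here as the sharp frame inequality): `Hs + hmax < R/2`. -/
def EmptyConeFrameP : RegimePred := fun _η _f _x₀ _s hmax R Hs _B _j _v _w => Hs + hmax < R / 2

/-- CONE-FREE CONFIGURATIONS (C3 regime (I) «cone unreachable», memo §4 (P4)/(P5)): with `δ = Re w − Re v` and `y = Im w`,
`Hs² < (R/2 − |δ|)² + y²` — no point of the far strip can lie in or on the child's pair light cone. -/
def ConeFreeP : RegimePred := fun _η _f _x₀ _s _hmax R Hs _B _j v w => Hs ^ 2 < (R / 2 - |w.re - v.re|) ^ 2 + w.im ^ 2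

/-- THE CORNER CELL (C3 memo §4 (P5)/(P5′)): the complement of the cone-free regime — `y ≤ y_c = √(Hs² − (R/2 − |δ|)²)`, the displaced child low
enough for the top corner of the far strip to reach its light cone.  The single non-formal residue of C3's closure map lives here. -/
def CornerCellP : RegimePred := fun η f x₀ s hmax R Hs B j v w => ¬ ConeFreeP η f x₀ s hmax R Hs B j v w

/-- (K, reals) thin ⇒ empty cone, given the frame clauses `0 < s`, `3·hmax < R`: `Hs + hmax ≤ R/270 + R/3 < R/2`. -/
theorem emptyCone_of_thin_reals {s hmax R Hs : ℝ} (hs : 0 < s) (h3 : 3 * hmax < R) (hHs : 270 * Hs ≤ R) (h540 : 540 * s < R) :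
    Hs + hmax < R / 2 := by
  have hR : 0 < R := by linarith
  nlinarith

/-- (K, reals) empty cone ⇒ cone-free, given `|δ| ≤ hmax` and `0 ≤ Hs`. -/
theorem coneFree_of_emptyCone_reals {hmax R Hs δ y : ℝ} (hδ : |δ| ≤ hmax) (hHs : 0 ≤ Hs) (h : Hs + hmax < R / 2) :
    Hs ^ 2 < (R / 2 - |δ|) ^ 2 + y ^ 2 := by
  have h1 : Hs < R / 2 - |δ| := by linarith
  have h2 : Hs ^ 2 < (R / 2 - |δ|) ^ 2 := by nlinarith
  nlinarith [sq_nonneg y]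

/-- (K) along the socket's binders the child displacement is at most the lowest state's height: `|Re w − Re v| ≤ Im v ≤ hmax`. -/
theorem abs_re_sub_le_hmax {η : ℝ} {f : ℂ → ℂ} {x₀ s hmax R Hs : ℝ} {B : ℕ} {j : ℕ} {v w : ℂ}
    (hlow : IsLowest StTrkDQ η f x₀ s hmax R Hs B j v) (hh : v.im ≤ hmax) (hdisc : ‖w - (v.re : ℂ)‖ ≤ |v.im|) :
    |w.re - v.re| ≤ hmax := by
  have hv : StColQ' η f x₀ s hmax R Hs B j v := hlow.1
  obtain ⟨-, -, hv0, -⟩ := hv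
  have h1 : |w.re - v.re| ≤ ‖w - (v.re : ℂ)‖ := by
    have h := Complex.abs_re_le_norm (w - (v.re : ℂ))
    simpa using h
  have h2 : |v.im| = v.im := abs_of_pos hv0
  linarith

/-- (K) THIN ⇒ EMPTY CONE at the level of laws: the empty-cone law gives the thin-frame law. -/
theorem underThin_of_underEmptyCone {θ : ℝ} (h : RemainderGainBoxSeamUnder EmptyConeFrameP θ) : RemainderGainBoxSeamUnder ThinFrameP θ := by
  intro η f x₀ s hmax R Hs B hE j v w hfar hch hlow hcol hh hRB hw0 hiso hw1 hwim hdisc hP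
  have hE' := hE
  obtain ⟨_, _, _, hs, _, _, h3, _, _, _, _, _, _, _, _, _⟩ := hE'
  exact h η f x₀ s hmax R Hs B hE j v w hfar hch hlow hcol hh hRB hw0 hiso hw1 hwim hdisc
    (emptyCone_of_thin_reals hs h3 hP.1 hP.2)

/-- (K) EMPTY CONE ⇒ CONE-FREE at the level of laws: the cone-free (bulk) law gives the empty-cone-frame law. -/
theorem underEmptyCone_of_underConeFree {θ : ℝ} (h : RemainderGainBoxSeamUnder ConeFreeP θ) : RemainderGainBoxSeamUnder EmptyConeFrameP θ := by
  intro η f x₀ s hmax R Hs B hE j v w hfar hch hlow hcol hh hRB hw0 hiso hw1 hwim hdisc hP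
  have hE' := hE
  obtain ⟨_, _, _, _, _, _, _, hHs, _, _, _, _, _, _, _, _⟩ := hE'
  exact h η f x₀ s hmax R Hs B hE j v w hfar hch hlow hcol hh hRB hw0 hiso hw1 hwim hdisc
    (coneFree_of_emptyCone_reals (abs_re_sub_le_hmax hlow hh hdisc) hHs hP)

/-- ★ (K) DESIGN NOTE 3 (i) AS A THEOREM: the cone-free (bulk) law ALONE gives the gain law on every thin frame — the corner cell is absent there. -/
theorem underThin_of_underConeFree {θ : ℝ} (h : RemainderGainBoxSeamUnder ConeFreeP θ) : RemainderGainBoxSeamUnder ThinFrameP θ :=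
  underThin_of_underEmptyCone (underEmptyCone_of_underConeFree h)

/-- ★★ (K) THE SOCKET IS «BULK LAW ∧ CORNER-CELL LEMMA», each with its own allowance. -/
theorem sig_of_coneFree_and_cornerCell {θ₁ θ₂ : ℝ} (hbulk : RemainderGainBoxSeamUnder ConeFreeP θ₁)
    (hcorner : RemainderGainBoxSeamUnder CornerCellP θ₂) : RemainderGainBoxSeamSig (max θ₁ θ₂) :=
  sig_of_under_cover₂ (fun η f x₀ s hmax R Hs B j v w => Classical.em (ConeFreeP η f x₀ s hmax R Hs B j v w)) hbulk hcorner

/-- (K) … and conversely the socket gives both pieces (so nothing is lost by the split). -/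
theorem coneFree_and_cornerCell_of_sig {θ : ℝ} (h : RemainderGainBoxSeamSig θ) :
    RemainderGainBoxSeamUnder ConeFreeP θ ∧ RemainderGainBoxSeamUnder CornerCellP θ :=
  ⟨under_of_sig h, under_of_sig h⟩

/-! ## Geometry of the cone-free label -/

/-- (K) in the cone-free regime (with `|δ| ≤ R/2`) every far point of the strip — `|Im u| ≤ Hs`, `|Re u − Re v| ≥ R/2` — leaves the child `w`
UNCOVERED: `(Im u)² < (Im w)² + (Re w − Re u)²`, the right-hand side of `RhW08.UncoveredSign.pairPull_neg_iff` («the pair `u, ū` pulls `w` down»). -/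
theorem far_uncovered {R Hs : ℝ} {u v w : ℂ} (hcf : Hs ^ 2 < (R / 2 - |w.re - v.re|) ^ 2 + w.im ^ 2) (hδ : |w.re - v.re| ≤ R / 2)
    (hu : |u.im| ≤ Hs) (hfar : R / 2 ≤ |u.re - v.re|) : u.im ^ 2 < w.im ^ 2 + (w.re - u.re) ^ 2 := by
  have h0 : 0 ≤ R / 2 - |w.re - v.re| := by linarith
  have h1 : R / 2 - |w.re - v.re| ≤ |u.re - w.re| := by
    have := abs_sub_abs_le_abs_sub (u.re - v.re) (w.re - v.re)
    have h' : u.re - v.re - (w.re - v.re) = u.re - w.re := by ring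
    rw [h'] at this
    linarith
  have h2 : (R / 2 - |w.re - v.re|) ^ 2 ≤ |u.re - w.re| ^ 2 := pow_le_pow_left₀ h0 h1 2
  have h3 : |u.re - w.re| ^ 2 = (w.re - u.re) ^ 2 := by rw [sq_abs]; ring
  have h4 : u.im ^ 2 ≤ Hs ^ 2 := by
    have h5 : |u.im| ^ 2 = u.im ^ 2 := sq_abs _
    have h6 : 0 ≤ |u.im| := abs_nonneg _
    nlinarith [pow_le_pow_left₀ h6 hu 2]
  linarith

/-- (K) along the socket's binders the cone-free label has its geometric meaning: `|δ| ≤ hmax < R/3 ≤ R/2` is automatic (`3·hmax < R`). -/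
theorem far_uncovered_of_binders {η : ℝ} {f : ℂ → ℂ} {x₀ s hmax R Hs : ℝ} {B : ℕ} {j : ℕ} {v w u : ℂ}
    (hE : EngineHyps5 2 η f x₀ s hmax R Hs B) (hlow : IsLowest StTrkDQ η f x₀ s hmax R Hs B j v) (hh : v.im ≤ hmax)
    (hdisc : ‖w - (v.re : ℂ)‖ ≤ |v.im|) (hcf : ConeFreeP η f x₀ s hmax R Hs B j v w)
    (hu : |u.im| ≤ Hs) (hfar : R / 2 ≤ |u.re - v.re|) : u.im ^ 2 < w.im ^ 2 + (w.re - u.re) ^ 2 := by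
  obtain ⟨_, _, _, _, _, _, h3, _, _, _, _, _, _, _, _, _⟩ := hE
  have hδ : |w.re - v.re| ≤ R / 2 := by
    have := abs_re_sub_le_hmax hlow hh hdisc
    linarith
  exact far_uncovered hcf hδ hu hfar

end RhW08.GainRegime

end
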